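import Summits.RiemannHypothesis.RiemannHypothesis.Theorems.SemilocalSoninPolyWeilSide
import Summits.RiemannHypothesis.RiemannHypothesis.Theorems.SoninCertEps
import Summits.RiemannHypothesis.RiemannHypothesis.Theorems.SoninCertBBound
import HarnessLib

/-!
# Sonin-section certificate for `S = {∞, 2}`: the ASSEMBLY — `¬ SemilocalSoninIneqOn 2 a` for every `a > 107/200`

Cell `rh-explicit`, seats cc-s2-1 (assembly text, gen4, `HOME/cc-s2-1/phase2/SoninCertAssembly.lean`, sha16
`18c61e46ecd2eb45`) and cc-s2-3 (the two kernel certificates and this landing), Phase 2 of lead rulings R7-12/R7-12a;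
target of record `∀ a, 107/200 < a → ¬ SemilocalSoninIneqOn 2 a` (L-milestone «L-S2-SONIN-2»).  With the G-side
(`SemilocalSoninPolyWindow`), the Weil side (`SemilocalSoninPolyWeilSide`), the data (`SoninCertData`, P1) and the vector
`η` (`SoninCertEta`, P2) in the tree, the target follows from two numerical facts about `η = SoninCert.eta`:
`(hε)` the band energy `∫_{[−1,1]} |𝓕η|² ≤ epsQ = 3·10⁻¹²` — PROVED in `SoninCertEps` (P3,
`integral_norm_sq_lpFourier_eta_le`) — and `(hB)` the Sonin-side lower bound `BloQ = 51/10⁴ ≤ Re⟨η | ϑ(T_2(G⋆G̃)) η⟩`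
for `G = polyWitness gL bQ` — PROVED in `SoninCertBBound` (P4, `BloQ_le_re_soninTraceForm`, on the kernel enclosure
`SoninCertBKernel`).  Everything else is discharged as in cc-s2-1's pre-assembly: the Weil-side record
`⟨gL, bQ, 14, 7, 5, 10, 40, _⟩` passes its enclosure side conditions and the budget `lhsQ − c2SharpQ·‖g‖₂² < CQ = 3/10³`
by `decide` (value `2.46033048·10⁻³`), and the remaining clauses are read off `SoninCert.checkData_eq_true`.
Main theorems: `not_semilocalSoninIneqOn_two_of_gt` (every `a > 107/200`) and, at CC's `S = {∞,2}` window,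
`not_semilocalSoninIneqOn_two_log_three_half` (`(log 3)/2 > 107/200`).  What this refutes is the OPERATOR-side obligation
`SemilocalSoninIneqOn 2 a` (tagged `@[conjecture]` in `Theorems/SemilocalSoninIneqOn.lean`: the one-vector form of the
semilocal Sonin-trace inequality at `S = {∞, 2}`); it says nothing about `ζ`.

Proof-only file (no definitions, no named facts). [folklore]
-/

set_option linter.dupNamespace false  -- the mandated namespace repeats `RiemannHypothesis`

noncomputable section

open MeasureTheory Complex Set Filter Topology Finset FourierTransform
open scoped Real ComplexConjugate ENNReal

namespace Summit.RiemannHypothesis.RiemannHypothesis.SoninCert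

open Literature.NumberTheory.LFunctions Literature.NumberTheory.ConnesConsani2021
  Summit.RiemannHypothesis.RiemannHypothesis.Theorems.MotivicDoor
  Summit.RiemannHypothesis.RiemannHypothesis.Theorems.SemilocalPolyWitness
  Summit.RiemannHypothesis.RiemannHypothesis.Theorems.SemilocalPolyWitness.LQ

/-- Enclosure side conditions of the Weil-side record `(gL, bQ; 14, 7, 5; 10, 40)`: `0 < b ≤ 1`, `b < log 2 ≤ 2b`
(20-digit enclosure), `D(0) = 0` on the increment list, and the tail ratio test. [folklore] -/
theorem weilRecord_sideConds :
    0 < bQ ∧ bQ ≤ 1 ∧ bQ < logTwoLo20 ∧ logTwoHi20 ≤ 2 * bQ ∧ (incrementL gL bQ).headD 0 = 0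
      ∧ invPartialExpQ 40 (2 * (2 * bQ)) < 1 := by
  decide +kernel

set_option maxHeartbeats 0 in  -- kernel evaluation of the rational enclosures (≈ 30 s); no search
/-- **The Weil budget holds**: `lhsQ − c2SharpQ·‖g‖₂² < CQ = 3/10³` for the record `(gL, bQ; 14, 7, 5; 10, 40)`. [folklore] -/
theorem weilRecord_budget :
    (⟨gL, bQ, 14, 7, 5, 10, 40, 1⟩ : WeilNegCert2).lhsQ - c2SharpQ * LQ.normSq gL bQ < CQ := by
  decide +kernel

/-- The clauses of `checkData` used by the assembly, unpacked from `checkData_eq_true`. [folklore] -/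
theorem data_clauses :
    evQ fL bQ = 0 ∧ evQ fL (-bQ) = 0 ∧ evQ (derivL fL) bQ = 0 ∧ evQ (derivL fL) (-bQ) = 0
      ∧ gL = LQ.add (derivL (derivL fL)) (LQ.smul (1 / 2) (derivL fL))
      ∧ (3 / 2 + 141422 / 100000) * (2 * bQ) * LQ.normSq gL bQ < KQ
      ∧ epsQ * 10000000 / 572 ≤ dQ ^ 2
      ∧ CQ * (GmHiQ + 4 * (2 * NHiQ + dQ) * dQ) < BloQ - KQ * (2 * NHiQ + dQ) * dQ := by
  have h := checkData_eq_true
  simp only [checkData, gNormSqQ, Bool.and_eq_true, decide_eq_true_eq] at h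
  obtain ⟨⟨⟨⟨⟨⟨⟨⟨⟨⟨⟨h1, h2⟩, h3⟩, h4⟩, h5⟩, _⟩, h7⟩, _⟩, h9⟩, h10⟩, _⟩, _⟩ := h
  exact ⟨h1, h2, h3, h4, h5, h7, h9, h10⟩

/-- **`¬ SemilocalSoninIneqOn 2 a` for every `a > 107/200`, modulo the two kernel certificates** `(hε)` band energy of
`η` at most `epsQ` (P3) and `(hB)` `BloQ ≤ Re⟨η|ϑ(T_2(G⋆G̃))η⟩` (P4). [folklore] -/
theorem not_semilocalSoninIneqOn_two_of_eta_certificates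
    (hε : ∫ x in Set.Icc (-1 : ℝ) 1, ‖((𝓕 eta : Lp ℂ 2 (volume : Measure ℝ)) : ℝ → ℂ) x‖ ^ 2 ≤ ((epsQ : ℚ) : ℝ))
    (hB : ((BloQ : ℚ) : ℝ) ≤ (soninTraceForm (twistKernel 2
      (weilConv (polyWitness gL bQ) (weilReflect (polyWitness gL bQ)))) (eta : ℝ → ℂ)).re)
    {a : ℝ} (ha : ((bQ : ℚ) : ℝ) < a) : ¬ SemilocalSoninIneqOn 2 a := by
  obtain ⟨hb0, hb1, hblog, h2b, hhead, htail⟩ := weilRecord_sideConds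
  obtain ⟨hF3, hF4, hF1, hF2, hg, hK, hd, hineq⟩ := data_clauses
  exact not_semilocalSoninIneqOn_two_of_polyWitness ⟨gL, bQ, 14, 7, 5, 10, 40, 1⟩ (F := fL) hb0 hb1 hblog h2b
    (by decide) (by decide) hhead htail hg hF1 hF2 hF3 hF4 weilRecord_budget (by rw [CQ]; norm_num) hK
    eta_mem_evenPart eta_mem_vanishOn hε hd (by rw [dQ]; norm_num) dQ_lt_norm_eta hB
    norm_sq_primeTwist_eta_le norm_eta_le hineq ha

/-- `107/200 < (log 3)/2` (`log 3 = log 2 − log(1 − 1/3)`, eight Taylor terms, `Real.log_two_gt_d9`). [folklore] -/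
theorem bQ_lt_log_three_half : ((bQ : ℚ) : ℝ) < Real.log 3 / 2 := by
  have h := Real.abs_log_sub_add_sum_range_le (x := (1 / 3 : ℝ)) (by rw [abs_of_pos (by norm_num)]; norm_num) 8
  rw [abs_of_pos (by norm_num : (0 : ℝ) < 1 / 3)] at h
  have hs : ∑ i ∈ range 8, (1 / 3 : ℝ) ^ (i + 1) / (i + 1) = 744857 / 1837080 := by
    simp only [sum_range_succ, sum_range_zero]
    norm_num
  rw [hs, show (1 : ℝ) - 1 / 3 = 2 / 3 by norm_num, Real.log_div (by norm_num) (by norm_num)] at h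
  have h2 := Real.log_two_gt_d9
  have h' := (abs_le.1 h).2
  rw [bQ]
  norm_num at h' ⊢
  linarith

/-- **At CC's `S = {∞, 2}` window**: `¬ SemilocalSoninIneqOn 2 ((log 3)/2)`, modulo the two kernel certificates. [folklore] -/
theorem not_semilocalSoninIneqOn_two_log_three_half_of_eta_certificates
    (hε : ∫ x in Set.Icc (-1 : ℝ) 1, ‖((𝓕 eta : Lp ℂ 2 (volume : Measure ℝ)) : ℝ → ℂ) x‖ ^ 2 ≤ ((epsQ : ℚ) : ℝ))
    (hB : ((BloQ : ℚ) : ℝ) ≤ (soninTraceForm (twistKernel 2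
      (weilConv (polyWitness gL bQ) (weilReflect (polyWitness gL bQ)))) (eta : ℝ → ℂ)).re) :
    ¬ SemilocalSoninIneqOn 2 (Real.log 3 / 2) :=
  not_semilocalSoninIneqOn_two_of_eta_certificates hε hB bQ_lt_log_three_half

/-- **THEOREM (L-S2-SONIN-2).**  For every `a > 107/200` the semilocal Sonin-trace obligation at `S = {∞, 2}` fails:
`¬ SemilocalSoninIneqOn 2 a` — unconditional (the two kernel certificates `SoninCertEps` and `SoninCertBBound` supply
`hε` and `hB`). [folklore] -/
theorem not_semilocalSoninIneqOn_two_of_gt {a : ℝ} (ha : ((bQ : ℚ) : ℝ) < a) : ¬ SemilocalSoninIneqOn 2 a :=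
  not_semilocalSoninIneqOn_two_of_eta_certificates integral_norm_sq_lpFourier_eta_le BloQ_le_re_soninTraceForm ha

/-- The same with the window written as the literal `107/200`. [folklore] -/
theorem not_semilocalSoninIneqOn_two_of_gt' {a : ℝ} (ha : (107 / 200 : ℝ) < a) : ¬ SemilocalSoninIneqOn 2 a :=
  not_semilocalSoninIneqOn_two_of_gt (by rw [bQ]; push_cast; linarith)

/-- **At CC's `S = {∞, 2}` window**: `¬ SemilocalSoninIneqOn 2 ((log 3)/2)` — unconditional. [folklore] -/
theorem not_semilocalSoninIneqOn_two_log_three_half : ¬ SemilocalSoninIneqOn 2 (Real.log 3 / 2) :=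
  not_semilocalSoninIneqOn_two_of_gt bQ_lt_log_three_half

end Summit.RiemannHypothesis.RiemannHypothesis.SoninCert

end
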